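import Summits.QuantumFields.GaugeBoot.WordCanon
import Summits.QuantumFields.GaugeBoot.Rung0D4Binding
import HarnessLib

/-!
# Witness-coded canonical relabelling of loop variables in `D = 4` (cell `gauge-boot`, LEQ-SCALING R1, `B₄` tables)

Cell `pub-gaugeboot` (HOME `run/shared/lean/pub/pub-gaugeboot/`), seat lean2 — the `D = 4` companion of `WordCanon.lean`
(design note `HOME/pub-gaugeboot-lean2/LEQ-SCALING.md`), for the rows-as-data treatment of the cell's `D = 4` `SU(2)` equality
systems (glyz-c1-4D 242 rows — the `𝓔` behind the certified 4D windows C20–C31 —, glyz-c2-4D 1056 rows, kz-L2-4D 1120 rows).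

HONEST FRAMING (page 1 of every file of this cell): certified bounds on lattice expectations at STATED coupling, gauge
group, dimension and torus size; NOT a mass gap, NOT a continuum limit, NOT a string tension, NOT large `N`; NOT
Yang–Mills-summit-bearing (barriers `FixedCouplingUltralocality`, `PerturbativeInvisibility`).

## Content

* `b4 g` — the 384 elements of `B₄` as move lists: `g = 16·p + s`, `p = d₁ + 2·d₂ + 6·d₃ < 24` in mixed radix with digit
  `d_k ∈ {0, …, k}` meaning the transposition `(d_k − 1, k)` (`0` = none), `s < 16` the sign bits;
* `Word.canonW4 c w` — the code `c = g + 512·rev + 1024·k₁ + 32768·k₂` selects `LoopClasses.Word.canon (b4 g) rev k₁ k₂`;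
* `W4_canonW4` : `Rung0D4.W β L (w.canonW4 c) = Rung0D4.W β L w` for every closed `w : Word 4` and EVERY code (lean1's
  `Rung0D4Binding.W`; closedness transported by `WordCanon.Word.disp_acts`), and `W4_canonW4_at` (any base point).
Everything is `[folklore]`.
-/

noncomputable section

open MeasureTheory
open Literature.MathematicalPhysics.QuantumFieldTheory

namespace Summit.QuantumFields.GaugeBoot

/-- The permutation part of a `B₄` code (`p < 24`, mixed radix `d₁ + 2·d₂ + 6·d₃`; digit `d_k = i + 1` is the transposition
`(i, k)`, `0` none; the `k = 1` transposition acts first). [folklore] -/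
def b4Perm (p : ℕ) : List (Move 4) :=
  (if p / 6 = 1 then [Move.perm (Equiv.swap 0 3)] else if p / 6 = 2 then [Move.perm (Equiv.swap 1 3)]
    else if p / 6 = 3 then [Move.perm (Equiv.swap 2 3)] else []) ++
  (if p / 2 % 3 = 1 then [Move.perm (Equiv.swap 0 2)] else if p / 2 % 3 = 2 then [Move.perm (Equiv.swap 1 2)] else []) ++
  (if p % 2 = 1 then [Move.perm (Equiv.swap 0 1)] else [])

/-- The sign part of a `B₄` code (`s < 16`: bit `j` set = reflect axis `j`). [folklore] -/
def b4Sign (s : ℕ) : List (Move 4) :=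
  (if s % 2 = 1 then [Move.refl 0] else []) ++ (if s / 2 % 2 = 1 then [Move.refl 1] else []) ++
    (if s / 4 % 2 = 1 then [Move.refl 2] else []) ++ (if s / 8 % 2 = 1 then [Move.refl 3] else [])

/-- The `B₄` element of code `g = 16·p + s` as a move list (signs act first). [folklore] -/
def b4 (g : ℕ) : List (Move 4) := b4Perm (g / 16) ++ b4Sign (g % 16)

namespace Word

/-- **Witness-coded canonicalisation, `D = 4`**: the code `c = g + 512·rev + 1024·k₁ + 32768·k₂` (`g < 512`, `k₁ < 32`)
selects `LoopClasses.Word.canon (b4 g) rev k₁ k₂`. [folklore] -/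
def canonW4 (c : ℕ) (w : Word 4) : Word 4 :=
  Word.canon (b4 (c % 512)) (decide (c / 512 % 2 = 1)) (c / 1024 % 32) (c / 32768) w

/-- `canonW4` preserves closedness. [folklore] -/
theorem disp_canonW4 (c : ℕ) {w : Word 4} (hw : disp w = 0) : disp (w.canonW4 c) = 0 := by
  unfold canonW4 Word.canon
  have h := disp_acts (b4 (c % 512)) hw
  split_ifs <;> simp [h]

end Word

/-- **Relabelling by ANY witness code preserves the loop variable** (`D = 4`): `Rung0D4.W β L (w.canonW4 c) = Rung0D4.W β L w`
for a closed word `w`. [folklore] -/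
theorem W4_canonW4 (β : ℝ) (L : ℕ) [NeZero L] (c : ℕ) (w : Word 4) (hw : Word.disp w = 0) :
    Rung0D4.W β L (w.canonW4 c) = Rung0D4.W β L w := by
  unfold Rung0D4.W Word.canonW4
  exact (wilsonExpectation_wordLoop_canon (suRep 2) (continuous_suRep 2) _ _ _ _ _ _ (Word.disp_acts _ hw)).symm

/-- The same from any base point of the torus (translation invariance). [folklore] -/
theorem W4_canonW4_at (β : ℝ) {L : ℕ} [NeZero L] (x : Site 4 L) (c : ℕ) (w : Word 4) (hw : Word.disp w = 0) :
    wilsonExpectation (suRep 2) (β / (2 : ℕ)) (wordLoop (suRep 2) x w) = Rung0D4.W β L (w.canonW4 c) := by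
  rw [W4_canonW4 β L c w hw, wilsonExpectation_wordLoop_translate (suRep 2) (β / (2 : ℕ)) x (0 : Site 4 L) w]
  rfl

/-- Example: the code `66048 = 0 + 512·1 + 1024·0 + 32768·2` (identity of `B₄`, reversed, rotations `0, 2`) carries
`−3 −0 +3 +0` to the plaquette label `+0 +3 −0 −3` (closed computation). [folklore] -/
example : Word.canonW4 66048 [.bwd 3, .bwd 0, .fwd 3, .fwd 0] = [.fwd 0, .fwd 3, .bwd 0, .bwd 3] := by decide

end Summit.QuantumFields.GaugeBoot

end
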